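import Literature.NumberTheory.GaloisRepresentations.GaloisRep
import Literature.NumberTheory.GaloisRepresentations.GaloisRepUnramifiedProofs
import Literature.NumberTheory.GaloisRepresentations.FrobeniusDensity
import Literature.NumberTheory.GaloisRepresentations.ArtinReciprocityCharacterProofs
import Literature.NumberTheory.GaloisRepresentations.WildInertia
import Literature.NumberTheory.GaloisRepresentations.LocalGaloisGroupFrobeniusProofs
import Literature.NumberTheory.GaloisRepresentations.LocalGaloisGroupProofs
import Literature.NumberTheory.Automorphic.AdicCompletionLocalField
import Mathlib.NumberTheory.Padics.Complex
import Mathlib.Analysis.Normed.Group.Ultra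
import HarnessLib

/-!
# Continuous `ℓ`-adic characters of a number field are unramified almost everywhere (proved)

Topic `NumberTheory/GaloisRepresentations`; namespace
`Literature.NumberTheory.GaloisRepresentations`.  A *proofs* file (theorems only; no definition,
no named fact).

* **`FramedGaloisRep.eventually_isUnramifiedAt_of_rank_one`** — for a number field `K`, a prime
  `ℓ` and a continuous character `ψ : Γ_K →ₜ* GL_1(ℚ̄_ℓ)` (`ℚ̄_ℓ = PadicAlgCl ℓ`), `ψ` is unramified
  at all but finitely many finite places `v` (`FramedGaloisRep.IsUnramifiedAt`: every inertia
  group `I_𝔓 ≤ Γ_K`, `𝔓 ∣ v`, dies).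

This is the standard remark that for ABELIAN `ℓ`-adic representations the hypothesis
"unramified outside a finite set" is automatic (class-field-theoretically: the image of
`∏_{v ∤ ℓ} 𝒪_vˣ` in an `ℓ`-adic Lie group is finite at each `v` and trivial for almost all `v`;
cf. Serre, *Abelian ℓ-adic representations* (1968), Ch. III §2.2, Remark, and the definition of
`ℓ`-adic representations of `K` "unramified outside a finite set" in Ch. I §2.1).  It is the
conjunct "`ψ_ℓ` is unramified at `v` for almost all `v`" in the conclusion of the tree's named fact
`exists_heckeCharacter_of_weaklyDivides` (Böckle–Hui 2025, Thm. 1.1, where the printed text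
ASSUMES the weak summand `ψ_ℓ` unramified almost everywhere, Def. 2.3; for characters nothing is
lost).  We give a Galois-theoretic proof that avoids class field theory:

1. (`exists_subgroup_units_norm_sub_one_lt`) In an ultrametric normed field the "one-units of
   level `r`", `U_r = {u : ‖u - 1‖ < r}` (`0 < r ≤ 1`), form an open subgroup of the units.
2. (`eq_one_of_pow_eq_one_of_norm_sub_one_lt`) **`U_{|ℓ|} ⊂ ℚ̄_ℓˣ` has no torsion**: from the
   ultrametric identities `‖x^m - 1‖ = ‖x - 1‖` for `‖m‖ = 1` and `‖x^ℓ - 1‖ = ‖ℓ‖ ‖x - 1‖` for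
   `‖x - 1‖ < ‖ℓ‖` (`x^n - 1 = (x - 1) ∑_{j<n} x^j` and `∑_{j<n} x^j ≡ n` modulo terms of norm
   `≤ ‖x - 1‖`).
3. (`ContinuousMonoidHom.apply_eq_one_of_mem_absInertia_of_norm_sub_one_lt`) **Local step**: for a
   non-archimedean local field `F` of residue characteristic `p ≠ ℓ` and a continuous character
   `χ : Γ_F → ℚ̄_ℓˣ` mapping the inertia group `I_F` into `U_{|ℓ|}`, `χ(I_F) = 1`.  Indeed the wild
   inertia `P_F` is pro-`p` (tree: `absWildInertia_isProP_holds`, Serre, *Local Fields* IV §2,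
   Cor. 3 of Prop. 7), so for `w ∈ P_F` and every `n` some `χ(w)^{pᵃ}` lies in `U_{|ℓ|ⁿ}`, while
   `‖χ(w)^{pᵃ} - 1‖ = ‖χ(w) - 1‖`; hence `χ(P_F) = 1`.  For `σ ∈ I_F` and an arithmetic
   Frobenius `τ`, `τ σ τ⁻¹ σ^{-q} ∈ P_F` (tree: `conj_mul_pow_inv_mem_absWildInertia`, Serre,
   Invent. Math. 15 (1972) §1.8 Prop. 6), so `χ(σ)^{q-1} = 1` with `χ(σ) ∈ U_{|ℓ|}`: `χ(σ) = 1`.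
4. **Global step**: `N = ψ⁻¹(U_{|ℓ|})` is an open subgroup of `Γ_K`, hence contains
   `Gal(K̄/E)` for a finite Galois `E/K` (Krull topology); the faithful permutation Artin
   representation of `Gal(E/K)` (tree:
   `absoluteGaloisGroup.exists_framedArtinRep_restrictNormalHom_eq`) is unramified at almost all
   `v` (`FramedArtinRep.eventually_isUnramifiedAt`), and at such `v`, by local–global
   compatibility of unramifiedness (tree: `GaloisRep.isUnramifiedAt_iff_toLocal_holds`,
   Neukirch II (9.6)), the local inertia `I_{K_v}` maps into `N`; discarding also the finitely
   many `v ∣ ℓ`, step 3 applied to `ψ|_{Γ_{K_v}}` shows that `ψ|_{Γ_{K_v}}` kills `I_{K_v}`, i.e.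
   (local–global compatibility again) `ψ` is unramified at `v`.

## References

* J.-P. Serre, *Abelian ℓ-adic representations and elliptic curves* (1968), Ch. I §2.1,
  Ch. III §2.2. [SerreAbelianLadic1968]
* J.-P. Serre, *Local Fields* (1979), Ch. IV §2, Prop. 7 and Cor. 1–3. [SerreLocalFields1979]
* J.-P. Serre, Invent. Math. 15 (1972), §1.3, §1.8 Prop. 6. [SerreInventiones1972]
* J. Neukirch, *Algebraic Number Theory* (1999), Ch. II §9 (9.6). [NeukirchANT1999]
* G. Böckle, C.-Y. Hui, Math. Ann. 393 (2025), Def. 2.3, Thm. 1.1. [BockleHui2025]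
-/

noncomputable section

open scoped NumberField Pointwise Topology
open Field ValuativeRel IsDedekindDomain Filter

namespace Literature.NumberTheory.GaloisRepresentations

open GaloisRepresentations.IsNonarchimedeanLocalField

universe u

/-! ### One-units in an ultrametric normed field -/

section Ultrametric

variable {L : Type*} [NormedField L] [IsUltrametricDist L]

/-- `‖x - 1‖ < 1 ⟹ ‖x‖ = 1` (ultrametric). [folklore] -/
theorem norm_eq_one_of_norm_sub_one_lt_one {x : L} (h : ‖x - 1‖ < 1) : ‖x‖ = 1 := by
  have hne : ‖x - 1‖ ≠ ‖(1 : L)‖ := by rw [norm_one]; exact h.ne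
  have := IsUltrametricDist.norm_add_eq_max_of_norm_ne_norm hne
  rw [sub_add_cancel, norm_one] at this
  rw [this, max_eq_right h.le]

/-- `‖∑_{j<n} x^j - n‖ ≤ ‖x - 1‖` for a one-unit `x` (each `x^j - 1 = (x-1)(1 + ⋯ + x^{j-1})` has
norm `≤ ‖x - 1‖`). [folklore] -/
theorem norm_geom_sum_sub_natCast_le {x : L} (h : ‖x - 1‖ < 1) (n : ℕ) :
    ‖(∑ j ∈ Finset.range n, x ^ j) - n‖ ≤ ‖x - 1‖ := by
  have hx1 : ‖x‖ = 1 := norm_eq_one_of_norm_sub_one_lt_one h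
  -- `‖x^j - 1‖ ≤ ‖x - 1‖`
  have hpow : ∀ j : ℕ, ‖x ^ j - 1‖ ≤ ‖x - 1‖ := fun j => by
    rw [← geom_sum_mul, norm_mul]
    refine mul_le_of_le_one_left (norm_nonneg _) ?_
    refine IsUltrametricDist.norm_sum_le_of_forall_le_of_nonneg zero_le_one fun i _ => ?_
    rw [norm_pow, hx1, one_pow]
  have hsum : (∑ j ∈ Finset.range n, x ^ j) - n = ∑ j ∈ Finset.range n, (x ^ j - 1) := by
    rw [Finset.sum_sub_distrib, Finset.sum_const, Finset.card_range, nsmul_eq_mul, mul_one]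
  rw [hsum]
  exact IsUltrametricDist.norm_sum_le_of_forall_le_of_nonneg (norm_nonneg _) fun j _ => hpow j

/-- **`‖xᵐ - 1‖ = ‖x - 1‖` for a one-unit `x` and `‖m‖ = 1`** (`xᵐ - 1 = (x - 1) ∑_{j<m} x^j`
and the sum is `≡ m`, a unit). [folklore] -/
theorem norm_pow_sub_one_of_norm_natCast_eq_one {x : L} (h : ‖x - 1‖ < 1) {m : ℕ}
    (hm : ‖(m : L)‖ = 1) : ‖x ^ m - 1‖ = ‖x - 1‖ := by
  have hS : ‖∑ j ∈ Finset.range m, x ^ j‖ = 1 := by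
    have hlt : ‖(∑ j ∈ Finset.range m, x ^ j) - m‖ < ‖(m : L)‖ :=
      (norm_geom_sum_sub_natCast_le h m).trans_lt (by rw [hm]; exact h)
    have := IsUltrametricDist.norm_add_eq_max_of_norm_ne_norm hlt.ne
    rw [sub_add_cancel] at this
    rw [this, max_eq_right hlt.le, hm]
  rw [← geom_sum_mul, norm_mul, hS, one_mul]

/-- **`‖x^ℓ - 1‖ = ‖ℓ‖ · ‖x - 1‖` when `‖x - 1‖ < ‖ℓ‖ ≤ 1`** (the sum `∑_{j<ℓ} x^j` is `≡ ℓ`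
modulo terms of norm `≤ ‖x - 1‖ < ‖ℓ‖`, hence has norm `‖ℓ‖`). [folklore] -/
theorem norm_pow_sub_one_of_norm_sub_one_lt_norm {x : L} {ℓ : ℕ} (hℓ : ‖(ℓ : L)‖ ≤ 1)
    (h : ‖x - 1‖ < ‖(ℓ : L)‖) : ‖x ^ ℓ - 1‖ = ‖(ℓ : L)‖ * ‖x - 1‖ := by
  have h1 : ‖x - 1‖ < 1 := h.trans_le hℓ
  have hS : ‖∑ j ∈ Finset.range ℓ, x ^ j‖ = ‖(ℓ : L)‖ := by
    have hlt : ‖(∑ j ∈ Finset.range ℓ, x ^ j) - ℓ‖ < ‖(ℓ : L)‖ :=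
      (norm_geom_sum_sub_natCast_le h1 ℓ).trans_lt h
    have := IsUltrametricDist.norm_add_eq_max_of_norm_ne_norm hlt.ne
    rw [sub_add_cancel] at this
    rw [this, max_eq_right hlt.le]
  rw [← geom_sum_mul, norm_mul, hS]

/-- **One-units of level `r` form an open subgroup**: for `0 < r ≤ 1` there is an open subgroup
`U` of `Lˣ` with `u ∈ U ↔ ‖u - 1‖ < r`. [folklore] -/
theorem exists_subgroup_units_norm_sub_one_lt {r : ℝ} (hr0 : 0 < r) (hr1 : r ≤ 1) :
    ∃ U : Subgroup Lˣ, (∀ u : Lˣ, u ∈ U ↔ ‖(u : L) - 1‖ < r) ∧ IsOpen (U : Set Lˣ) := by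
  refine ⟨{ carrier := {u | ‖(u : L) - 1‖ < r}
            one_mem' := by simp [hr0]
            mul_mem' := fun {u v} hu hv => ?_
            inv_mem' := fun {u} hu => ?_ }, fun u => Iff.rfl, ?_⟩
  · simp only [Set.mem_setOf_eq, Units.val_mul] at hu hv ⊢
    have hu1 : ‖(u : L)‖ = 1 := norm_eq_one_of_norm_sub_one_lt_one (hu.trans_le hr1)
    have : (u : L) * v - 1 = u * (v - 1) + (u - 1) := by ring
    rw [this]
    refine (IsUltrametricDist.norm_add_le_max _ _).trans_lt (max_lt ?_ hu)
    rw [norm_mul, hu1, one_mul]; exact hv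
  · simp only [Set.mem_setOf_eq, Units.val_inv_eq_inv_val] at hu ⊢
    have hu1 : ‖(u : L)‖ = 1 := norm_eq_one_of_norm_sub_one_lt_one (hu.trans_le hr1)
    have : ((u : L))⁻¹ - 1 = (u : L)⁻¹ * (1 - u) := by
      rw [mul_sub, mul_one, inv_mul_cancel₀ u.ne_zero]
    rw [this, norm_mul, norm_inv, hu1, inv_one, one_mul, norm_sub_rev]
    exact hu
  · change IsOpen {u : Lˣ | ‖(u : L) - 1‖ < r}
    exact isOpen_lt (continuous_norm.comp (Units.continuous_val.sub continuous_const))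
      continuous_const

end Ultrametric

/-! ### `U_{|ℓ|} ⊂ ℚ̄_ℓˣ` is torsion-free -/

section PadicAlgCl

variable {ℓ : ℕ} [Fact ℓ.Prime]

/-- `‖ℓ‖ = ℓ⁻¹` in `ℚ̄_ℓ`. [folklore] -/
theorem PadicAlgCl.norm_natCast_self : ‖(ℓ : PadicAlgCl ℓ)‖ = (ℓ : ℝ)⁻¹ := by
  rw [← map_natCast (algebraMap ℚ_[ℓ] (PadicAlgCl ℓ)) ℓ, ← PadicAlgCl.coe_eq]
  change ‖((ℓ : ℚ_[ℓ]) : PadicAlgCl ℓ)‖ = _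
  rw [PadicAlgCl.norm_extends, Padic.norm_p]

/-- `‖ℓ‖ < 1` in `ℚ̄_ℓ`. [folklore] -/
theorem PadicAlgCl.norm_natCast_self_lt_one : ‖(ℓ : PadicAlgCl ℓ)‖ < 1 := by
  rw [PadicAlgCl.norm_natCast_self]
  exact inv_lt_one_of_one_lt₀ (by exact_mod_cast (Fact.out : ℓ.Prime).one_lt)

/-- `‖m‖ = 1` in `ℚ̄_ℓ` for `ℓ ∤ m`. [folklore] -/
theorem PadicAlgCl.norm_natCast_eq_one_of_not_dvd {m : ℕ} (hm : ¬ ℓ ∣ m) :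
    ‖(m : PadicAlgCl ℓ)‖ = 1 := by
  rw [← map_natCast (algebraMap ℚ_[ℓ] (PadicAlgCl ℓ)) m, ← PadicAlgCl.coe_eq]
  change ‖((m : ℚ_[ℓ]) : PadicAlgCl ℓ)‖ = _
  rw [PadicAlgCl.norm_extends, Padic.norm_natCast_eq_one_iff]
  exact (Nat.Prime.coprime_iff_not_dvd (Fact.out : ℓ.Prime)).mpr hm

/-- **The one-units of level `|ℓ|` in `ℚ̄_ℓ` contain no root of unity `≠ 1`**: if
`‖x - 1‖ < ‖ℓ‖` and `xⁿ = 1` (`n ≥ 1`) then `x = 1`.  Write `n = ℓᵏ m` with `ℓ ∤ m`; then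
`z = x^{ℓᵏ}` has `‖zᵐ - 1‖ = ‖z - 1‖`, so `z = 1`, and `‖x^ℓ - 1‖ = ‖ℓ‖ ‖x - 1‖` peels off the
powers of `ℓ`. [folklore] -/
theorem PadicAlgCl.eq_one_of_pow_eq_one_of_norm_sub_one_lt {x : PadicAlgCl ℓ}
    (hx : ‖x - 1‖ < ‖(ℓ : PadicAlgCl ℓ)‖) {n : ℕ} (hn : 0 < n) (hxn : x ^ n = 1) : x = 1 := by
  have hℓ1 : ‖(ℓ : PadicAlgCl ℓ)‖ ≤ 1 := PadicAlgCl.norm_natCast_self_lt_one.le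
  have hℓ0 : 0 < ‖(ℓ : PadicAlgCl ℓ)‖ := by
    rw [PadicAlgCl.norm_natCast_self]
    exact inv_pos.mpr (by exact_mod_cast (Fact.out : ℓ.Prime).pos)
  obtain ⟨k, m, hm, rfl⟩ := Nat.exists_eq_pow_mul_and_not_dvd hn.ne' ℓ (Fact.out : ℓ.Prime).ne_one
  -- the prime-to-`ℓ` part
  have hz : x ^ ℓ ^ k = 1 := by
    set z := x ^ ℓ ^ k with hzdef
    have hz1 : ‖z - 1‖ < 1 := by
      have := norm_geom_sum_sub_natCast_le (hx.trans_le hℓ1) (ℓ ^ k)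
      have h' : ‖x ^ ℓ ^ k - 1‖ ≤ ‖x - 1‖ := by
        rw [← geom_sum_mul, norm_mul]
        refine mul_le_of_le_one_left (norm_nonneg _) ?_
        refine IsUltrametricDist.norm_sum_le_of_forall_le_of_nonneg zero_le_one fun i _ => ?_
        rw [norm_pow, norm_eq_one_of_norm_sub_one_lt_one (hx.trans_le hℓ1), one_pow]
      exact h'.trans_lt (hx.trans_le hℓ1)
    have hzm : z ^ m = 1 := by rw [hzdef, ← pow_mul, hxn]
    have := norm_pow_sub_one_of_norm_natCast_eq_one hz1
      (PadicAlgCl.norm_natCast_eq_one_of_not_dvd hm)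
    rw [hzm, sub_self, norm_zero] at this
    exact sub_eq_zero.mp (norm_eq_zero.mp this.symm)
  -- peel off the powers of `ℓ`
  clear hxn hn hm
  induction k generalizing x with
  | zero => simpa using hz
  | succ k ih =>
    have hxl : ‖x ^ ℓ - 1‖ = ‖(ℓ : PadicAlgCl ℓ)‖ * ‖x - 1‖ :=
      norm_pow_sub_one_of_norm_sub_one_lt_norm hℓ1 hx
    have hxl' : ‖x ^ ℓ - 1‖ < ‖(ℓ : PadicAlgCl ℓ)‖ := by
      rw [hxl]
      exact mul_lt_of_lt_one_right hℓ0 (hx.trans_le hℓ1)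
    have h1 : x ^ ℓ = 1 := ih hxl' (by rw [← pow_mul, ← pow_succ']; exact hz)
    rw [h1, sub_self, norm_zero] at hxl
    have : ‖x - 1‖ = 0 := by
      rcases mul_eq_zero.mp hxl.symm with h | h
      · exact absurd h hℓ0.ne'
      · exact h
    exact sub_eq_zero.mp (norm_eq_zero.mp this)

end PadicAlgCl

/-! ### Local step: characters of `Γ_F`, `F` local of residue characteristic `≠ ℓ` -/

section Local

variable {F : Type u} [Field F] [ValuativeRel F] [TopologicalSpace F] [IsNonarchimedeanLocalField F]
variable {ℓ : ℕ} [Fact ℓ.Prime]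

/-- **A continuous `ℚ̄_ℓˣ`-valued character of `Γ_F` mapping inertia into the one-units of level
`|ℓ|` kills the wild inertia group**, for `F` a non-archimedean local field of residue
characteristic `p ≠ ℓ`: `P_F` is pro-`p` (`absWildInertia_isProP_holds`), so for `w ∈ P_F` and
every `n` some power `χ(w)^{pᵃ}` lies in the open subgroup `U_{|ℓ|ⁿ⁺¹}`, while
`‖χ(w)^{pᵃ} - 1‖ = ‖χ(w) - 1‖` (`‖pᵃ‖ = 1`); hence `‖χ(w) - 1‖ = 0`.
Ref: Serre, *Local Fields*, Ch. IV §2, Cor. 3 of Prop. 7.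
[cite: SerreLocalFields1979, Ch. IV §2 Cor. 3 of Prop. 7] -/
theorem ContinuousMonoidHom.apply_eq_one_of_mem_absWildInertia_of_norm_sub_one_lt
    (hp : ¬ ringChar 𝓀[F] ∣ ℓ) (χ : absoluteGaloisGroup F →ₜ* (PadicAlgCl ℓ)ˣ)
    (hχ : ∀ σ ∈ absInertia F, ‖((χ σ : (PadicAlgCl ℓ)ˣ) : PadicAlgCl ℓ) - 1‖ < ‖(ℓ : PadicAlgCl ℓ)‖)
    {ϖ : 𝒪[F]} (hϖ : Irreducible ϖ) {w : absoluteGaloisGroup F} (hw : w ∈ absWildInertia F ϖ) :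
    χ w = 1 := by
  have hpp : (ringChar 𝓀[F]).Prime := ringChar_residueField_prime (F := F)
  have hℓ1 : ‖(ℓ : PadicAlgCl ℓ)‖ < 1 := PadicAlgCl.norm_natCast_self_lt_one
  have hℓ0 : 0 < ‖(ℓ : PadicAlgCl ℓ)‖ := by
    rw [PadicAlgCl.norm_natCast_self]
    exact inv_pos.mpr (by exact_mod_cast (Fact.out : ℓ.Prime).pos)
  set x : PadicAlgCl ℓ := ((χ w : (PadicAlgCl ℓ)ˣ) : PadicAlgCl ℓ) with hxdef
  have hx : ‖x - 1‖ < ‖(ℓ : PadicAlgCl ℓ)‖ := hχ w (absWildInertia_le_absInertia F ϖ hw)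
  have hx1 : ‖x - 1‖ < 1 := hx.trans hℓ1
  -- `‖x - 1‖ < ‖ℓ‖ ^ (n + 1)` for every `n`
  have hsmall : ∀ n : ℕ, ‖x - 1‖ < ‖(ℓ : PadicAlgCl ℓ)‖ ^ (n + 1) := fun n => by
    obtain ⟨U, hU, hUo⟩ := exists_subgroup_units_norm_sub_one_lt (L := PadicAlgCl ℓ)
      (pow_pos hℓ0 (n + 1)) (pow_le_one₀ hℓ0.le hℓ1.le)
    obtain ⟨a, ha⟩ := absWildInertia_isProP_holds F hϖ hw (U.comap χ.toMonoidHom)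
      (hUo.preimage χ.continuous)
    have ha' : ‖x ^ (ringChar 𝓀[F] ^ a) - 1‖ < ‖(ℓ : PadicAlgCl ℓ)‖ ^ (n + 1) := by
      have h := (hU _).mp (Subgroup.mem_comap.mp ha)
      have e : ((χ.toMonoidHom (w ^ ringChar 𝓀[F] ^ a) : (PadicAlgCl ℓ)ˣ) : PadicAlgCl ℓ) =
          x ^ (ringChar 𝓀[F] ^ a) := by
        rw [hxdef, ← Units.val_pow_eq_pow_val, ← map_pow]; rfl
      rwa [e] at h
    have hpa : ‖((ringChar 𝓀[F] ^ a : ℕ) : PadicAlgCl ℓ)‖ = 1 := by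
      refine PadicAlgCl.norm_natCast_eq_one_of_not_dvd fun h => hp ?_
      have := (Nat.Prime.dvd_of_dvd_pow (Fact.out : ℓ.Prime) h)
      rw [(Nat.prime_dvd_prime_iff_eq (Fact.out : ℓ.Prime) hpp).mp this]
    rwa [norm_pow_sub_one_of_norm_natCast_eq_one hx1 hpa] at ha'
  -- hence `x = 1`
  have hx0 : ‖x - 1‖ = 0 := by
    by_contra hne
    have hpos : 0 < ‖x - 1‖ := lt_of_le_of_ne (norm_nonneg _) (Ne.symm hne)
    obtain ⟨n, hn⟩ := exists_pow_lt_of_lt_one hpos hℓ1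
    have := (hsmall n).trans (pow_lt_pow_right_of_lt_one₀ hℓ0 hℓ1 (Nat.lt_succ_self n))
    exact lt_irrefl _ (hn.trans this)
  exact Units.ext (sub_eq_zero.mp (norm_eq_zero.mp hx0))

/-- **Local step.**  Let `F` be a non-archimedean local field of residue characteristic `p ≠ ℓ`
and `χ : Γ_F →ₜ* ℚ̄_ℓˣ` a continuous character with `‖χ(σ) - 1‖ < ‖ℓ‖` for all `σ` in the
inertia group `I_F`.  Then `χ(I_F) = 1`.  With `τ` an arithmetic Frobenius
(`exists_isAbsArithFrob_holds`) and `σ ∈ I_F`, `τ σ τ⁻¹ σ^{-q} ∈ P_F`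
(`conj_mul_pow_inv_mem_absWildInertia`) and `χ(P_F) = 1` (previous theorem), so
`χ(σ)^{q-1} = 1`; a root of unity in the one-units of level `|ℓ|` is trivial
(`PadicAlgCl.eq_one_of_pow_eq_one_of_norm_sub_one_lt`).
Ref: Serre, *Local Fields*, Ch. IV §2, Prop. 7 and Cor. 1–3; Serre, Invent. Math. 15 (1972),
§1.8 Prop. 6. [cite: SerreLocalFields1979, Ch. IV §2 Prop. 7, Cor. 1–3]
[cite: SerreInventiones1972, §1.8 Prop. 6] -/
theorem ContinuousMonoidHom.apply_eq_one_of_mem_absInertia_of_norm_sub_one_lt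
    (hp : ¬ ringChar 𝓀[F] ∣ ℓ) (χ : absoluteGaloisGroup F →ₜ* (PadicAlgCl ℓ)ˣ)
    (hχ : ∀ σ ∈ absInertia F, ‖((χ σ : (PadicAlgCl ℓ)ˣ) : PadicAlgCl ℓ) - 1‖ < ‖(ℓ : PadicAlgCl ℓ)‖)
    {σ : absoluteGaloisGroup F} (hσ : σ ∈ absInertia F) : χ σ = 1 := by
  obtain ⟨ϖ, hϖ⟩ := IsDiscreteValuationRing.exists_irreducible 𝒪[F]
  obtain ⟨τ, hτ⟩ := exists_isAbsArithFrob_holds F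
  have hτ1 : IsFrobPow τ ((1 : ℕ) : ℤ) := IsAbsArithFrob.isFrobPow_holds hτ
  have hw := conj_mul_pow_inv_mem_absWildInertia hϖ.ne_zero hτ1 hσ
  have h1 := ContinuousMonoidHom.apply_eq_one_of_mem_absWildInertia_of_norm_sub_one_lt hp χ hχ hϖ hw
  rw [map_mul, map_mul, map_mul, map_inv, map_inv, map_pow, pow_one] at h1
  have h2 : χ τ * χ σ * (χ τ)⁻¹ = χ σ := by
    rw [mul_comm (χ τ) (χ σ), mul_assoc, mul_inv_cancel, mul_one]
  rw [h2, mul_inv_eq_one] at h1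
  -- `h1 : χ σ = χ σ ^ q`, so `χ σ ^ (q - 1) = 1`
  have hq := one_lt_residueFieldCard F
  have h3 : χ σ ^ (residueFieldCard F - 1) = 1 := by
    have h : χ σ ^ (residueFieldCard F - 1) * χ σ = 1 * χ σ := by
      rw [← pow_succ, Nat.sub_add_cancel hq.le, one_mul]
      exact h1.symm
    exact mul_right_cancel h
  have h4 : (((χ σ : (PadicAlgCl ℓ)ˣ) : PadicAlgCl ℓ)) ^ (residueFieldCard F - 1) = 1 := by
    rw [← Units.val_pow_eq_pow_val, h3, Units.val_one]
  exact Units.ext (PadicAlgCl.eq_one_of_pow_eq_one_of_norm_sub_one_lt (hχ σ hσ)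
    (Nat.sub_pos_of_lt hq) h4)

end Local

/-! ### Global step: characters of `Γ_K`, `K` a number field -/

section Global

variable {K : Type} [Field K] [NumberField K] {ℓ : ℕ} [Fact ℓ.Prime]

/-- **An open subgroup of `Gal(L/K)` contains `Gal(L/E)` for a finite Galois subextension `E`**
(the `Gal(L/E)`, `E/K` finite Galois, form a neighbourhood basis of `1` in the Krull topology;
Mathlib `krullTopology_mem_nhds_one_iff_of_normal`). [folklore] -/
theorem exists_fixingSubgroup_le_of_isOpen {k L : Type*} [Field k] [Field L] [Algebra k L]
    [Normal k L] (N : Subgroup Gal(L/k)) (hN : IsOpen (N : Set Gal(L/k))) :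
    ∃ E : IntermediateField k L, FiniteDimensional k E ∧ Normal k E ∧ E.fixingSubgroup ≤ N := by
  obtain ⟨E, hfd, hn, hE⟩ :=
    (krullTopology_mem_nhds_one_iff_of_normal k L (N : Set Gal(L/k))).mp (hN.mem_nhds N.one_mem)
  exact ⟨E, hfd, hn, fun σ hσ => hE hσ⟩

/-- For a framed representation, `ρ.toContinuousRep g = 1 ↔ ρ g = 1` (the standard
representation of `GL_n` is faithful). [folklore] -/
theorem FramedRep.toContinuousRep_apply_eq_one_iff {G : Type*} [Group G] [TopologicalSpace G]
    {A : Type*} [CommRing A] [TopologicalSpace A] [IsTopologicalRing A] {n : ℕ}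
    (ρ : FramedRep G A n) (g : G) : ρ.toContinuousRep g = 1 ↔ ρ g = 1 := by
  change FramedRep.toRepresentation ρ g = 1 ↔ ρ g = 1
  constructor
  · intro h
    have h1 : Matrix.toLin' ((ρ g : GL (Fin n) A) : Matrix (Fin n) (Fin n) A) =
        Matrix.toLin' 1 := by
      rw [Matrix.toLin'_one]
      refine LinearMap.ext fun v => ?_
      simpa using congr($h v)
    exact Units.ext (Matrix.toLin'.injective h1)
  · intro h
    refine LinearMap.ext fun v => ?_
    simp [h]

omit [Fact ℓ.Prime] in
/-- The residue characteristic of `K_v` (for the `ValuativeRel` structure of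
`AdicCompletionLocalField`) does not divide `ℓ` when `v ∤ ℓ` (same argument as
`EllipticCurves.…not_ringChar_residueField_adicCompletion_dvd`: otherwise `ℓ` is a non-unit of
`𝒪[K_v]`, i.e. `v(ℓ) < 1`, i.e. `ℓ ∈ v`). [folklore] -/
theorem not_ringChar_residueField_adicCompletion_dvd_of_not_mem {v : HeightOneSpectrum (𝓞 K)}
    (hv : (ℓ : 𝓞 K) ∉ v.asIdeal) : ¬ ringChar 𝓀[v.adicCompletion K] ∣ ℓ := by
  intro h
  have h0 : ((ℓ : ℕ) : 𝓀[v.adicCompletion K]) = 0 := (ringChar.spec 𝓀[v.adicCompletion K] ℓ).2 h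
  have h1 : ¬ IsUnit ((ℓ : ℕ) : 𝒪[v.adicCompletion K]) := fun hu => by
    have h' := hu.map (IsLocalRing.residue 𝒪[v.adicCompletion K])
    rw [map_natCast] at h'
    exact h'.ne_zero h0
  rw [Valuation.Integer.not_isUnit_iff_valuation_lt_one] at h1
  have h2 : Valued.v (((ℓ : ℕ) : 𝒪[v.adicCompletion K]) : v.adicCompletion K) < 1 :=
    (Valuation.vlt_one_iff
      (Valued.v : Valuation (v.adicCompletion K) (WithZero (Multiplicative ℤ)))).mp
      ((Valuation.vlt_one_iff (ValuativeRel.valuation (v.adicCompletion K))).mpr h1)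
  have h3 : (((ℓ : ℕ) : 𝒪[v.adicCompletion K]) : v.adicCompletion K) =
      ((algebraMap (𝓞 K) K ℓ : K) : v.adicCompletion K) := by
    rw [SubringClass.coe_natCast, map_natCast]
    exact (map_natCast (algebraMap K (v.adicCompletion K)) ℓ).symm
  rw [h3, HeightOneSpectrum.valuedAdicCompletion_eq_valuation',
    HeightOneSpectrum.valuation_lt_one_iff_mem] at h2
  exact hv h2

/-- **A continuous `ℓ`-adic character of a number field is unramified at all but finitely many
places.**  For `ψ : Γ_K →ₜ* GL_1(ℚ̄_ℓ)`: `N = ψ⁻¹(U_{|ℓ|})` (`U_{|ℓ|}` the one-units of level `|ℓ|`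
of `ℚ̄_ℓ`) is an open subgroup, so contains `Gal(K̄/E)` for a finite Galois `E/K`
(`krullTopology_mem_nhds_one_iff_of_normal`); a faithful Artin representation `ρ` of `Gal(E/K)`
(`absoluteGaloisGroup.exists_framedArtinRep_restrictNormalHom_eq`) is unramified at almost all `v`
(`FramedArtinRep.eventually_isUnramifiedAt`), and at such `v ∤ ℓ` the local inertia group
`I_{K_v}` maps into `ker ρ ⊆ N` (`GaloisRep.isUnramifiedAt_iff_toLocal_holds`, `→`), so the local
step (`ContinuousMonoidHom.apply_eq_one_of_mem_absInertia_of_norm_sub_one_lt`, for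
`det ∘ ψ|_{Γ_{K_v}}`) gives `ψ(I_{K_v}) = 1`, i.e. `ψ` is unramified at `v`
(`GaloisRep.isUnramifiedAt_iff_toLocal_holds`, `←`).
Ref: Serre, *Abelian ℓ-adic representations* (1968), Ch. I §2.1 and Ch. III §2.2 (Remark);
this is the conjunct "`ψ_ℓ` unramified at almost all `v`" of Böckle–Hui 2025, Thm. 1.1 /
Def. 2.3 in the tree's `exists_heckeCharacter_of_weaklyDivides`.
[cite: SerreAbelianLadic1968, Ch. III §2.2] -/
theorem FramedGaloisRep.eventually_isUnramifiedAt_of_rank_one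
    (ψ : FramedGaloisRep K (PadicAlgCl ℓ) 1) :
    ∀ᶠ v : HeightOneSpectrum (𝓞 K) in cofinite, ψ.IsUnramifiedAt v := by
  classical
  have hℓ1 : ‖(ℓ : PadicAlgCl ℓ)‖ < 1 := PadicAlgCl.norm_natCast_self_lt_one
  have hℓ0 : 0 < ‖(ℓ : PadicAlgCl ℓ)‖ := by
    rw [PadicAlgCl.norm_natCast_self]
    exact inv_pos.mpr (by exact_mod_cast (Fact.out : ℓ.Prime).pos)
  -- the open subgroup `N = (det ψ)⁻¹ (U_{|ℓ|})`
  obtain ⟨U, hU, hUo⟩ := exists_subgroup_units_norm_sub_one_lt (L := PadicAlgCl ℓ) hℓ0 hℓ1.le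
  set χ : absoluteGaloisGroup K →ₜ* (PadicAlgCl ℓ)ˣ := FramedRep.det ψ with hχdef
  set N : Subgroup (absoluteGaloisGroup K) := U.comap χ.toMonoidHom with hNdef
  have hNo : IsOpen (N : Set (absoluteGaloisGroup K)) := hUo.preimage χ.continuous
  -- `N ⊇ Gal(K̄/E)` for a finite Galois `E`
  obtain ⟨E, hEfd, hEn, hEN⟩ :=
    exists_fixingSubgroup_le_of_isOpen (k := K) (L := AlgebraicClosure K) N hNo
  haveI := hEfd
  haveI := hEn
  -- a faithful Artin representation of `Gal(E/K)`
  obtain ⟨m, ρ, hρ⟩ := absoluteGaloisGroup.exists_framedArtinRep_restrictNormalHom_eq (K := K) E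
  have hker : ∀ g : absoluteGaloisGroup K, ρ g = 1 → g ∈ N := fun g hg => by
    apply hEN
    have h1 := hρ g 1 (by rw [hg, map_one])
    rw [map_one, map_one] at h1
    change AlgEquiv.restrictNormal (absoluteGaloisGroup.toAlgEquiv K g) E = 1 at h1
    rw [AlgEquiv.restrictNormal_eq_one_iff] at h1
    exact (IntermediateField.mem_fixingSubgroup_iff E _).mpr h1
  -- the two cofinite conditions
  have hfin : ∀ᶠ v : HeightOneSpectrum (𝓞 K) in cofinite, (ℓ : 𝓞 K) ∉ v.asIdeal := by
    have hne : (Ideal.span {(ℓ : 𝓞 K)} : Ideal (𝓞 K)) ≠ ⊥ := by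
      rw [Ne, Ideal.span_singleton_eq_bot, Nat.cast_eq_zero]
      exact (Fact.out : ℓ.Prime).ne_zero
    rw [Filter.eventually_cofinite]
    refine (Ideal.finite_factors hne).subset fun v hv => ?_
    simp only [Set.mem_setOf_eq, not_not] at hv ⊢
    exact (Ideal.dvd_span_singleton).mpr hv
  filter_upwards [FramedArtinRep.eventually_isUnramifiedAt ρ, hfin] with v hρv hℓv
  -- local–global compatibility for `ρ` (→) and for `ψ` (←)
  have hρv' : ρ.toGaloisRep.IsUnramifiedAt v := (ρ.isUnramifiedAt_toGaloisRep_iff v).mpr hρv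
  have hρloc := (GaloisRep.isUnramifiedAt_iff_toLocal_holds v ρ.toGaloisRep).mp hρv'
  rw [← FramedGaloisRep.isUnramifiedAt_toGaloisRep_iff]
  refine (GaloisRep.isUnramifiedAt_iff_toLocal_holds v ψ.toGaloisRep).mpr fun τ hτ => ?_
  -- the local character `det ∘ ψ ∘ res`
  set χv : absoluteGaloisGroup (v.adicCompletion K) →ₜ* (PadicAlgCl ℓ)ˣ :=
    χ.comp (absGaloisRestrict K (v.adicCompletion K)) with hχv
  have hχvI : ∀ σ ∈ absInertia (v.adicCompletion K),
      ‖((χv σ : (PadicAlgCl ℓ)ˣ) : PadicAlgCl ℓ) - 1‖ < ‖(ℓ : PadicAlgCl ℓ)‖ := fun σ hσ => by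
    have h1 : ρ (absGaloisRestrict K (v.adicCompletion K) σ) = 1 := by
      have := hρloc σ hσ
      rw [GaloisRep.toLocal_apply] at this
      exact (FramedRep.toContinuousRep_apply_eq_one_iff ρ _).mp this
    have h2 : absGaloisRestrict K (v.adicCompletion K) σ ∈ N := hker _ h1
    rw [hNdef, Subgroup.mem_comap, hU] at h2
    exact h2
  have hone := ContinuousMonoidHom.apply_eq_one_of_mem_absInertia_of_norm_sub_one_lt
    (not_ringChar_residueField_adicCompletion_dvd_of_not_mem hℓv) χv hχvI hτ
  -- `det (ψ (res τ)) = 1`, hence `ψ (res τ) = 1` in `GL_1`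
  have hdet :
      Matrix.GeneralLinearGroup.det (ψ (absGaloisRestrict K (v.adicCompletion K) τ)) = 1 := hone
  have hψ1 : ψ (absGaloisRestrict K (v.adicCompletion K) τ) = 1 := by
    refine Units.ext (Matrix.ext fun i j => ?_)
    have h := congrArg (fun u : (PadicAlgCl ℓ)ˣ => (u : PadicAlgCl ℓ)) hdet
    simp only [Matrix.GeneralLinearGroup.val_det_apply, Matrix.det_fin_one, Units.val_one] at h
    rw [Subsingleton.elim i 0, Subsingleton.elim j 0, h]
    simp
  rw [GaloisRep.toLocal_apply]
  exact (FramedRep.toContinuousRep_apply_eq_one_iff ψ _).mpr hψ1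

end Global

end Literature.NumberTheory.GaloisRepresentations
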